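import Summits.Ventures.Crystal3D.Theorems.StickyWulffConstantTextureLiminfTexShadowFamSplitDefs
import HarnessLib

/-!
# TexShadow at LAW v5 — the two-plate wall law and its cells AT A GENERIC CHARGE CAP `c₀` (T-V5 PORT, file P3)
# (lane T; new crux `TextureLiminfV5`, stmt-Ventures-23912; cf-p1 g30 memo HOME/cf-p1/T-V5-PORT.md, decisions (lx)/(lxix)/(lxxii))

HONEST FRAMING. Venture `Summits/Ventures/Crystal3D` (cell `crystal3d-full`), route `route-Ventures-StickyWulffConstant`, helper
`--supports` the law-v5 crux `TextureLiminfV5` (stmt-Ventures-23912).  DEFINITIONS + one-line monotonicity lemmas only; nothing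
about any wall law is proved or claimed; rung F-C1 not moved.

THE ONE OBSERVATION (memo §«what makes the port cheap»).  The v4 wall vocabulary of record (`…TexShadowSplitDefs` §2/§2b,
`…FamSplitDefs`, `…OnReachSplit`, `…WeakZigSplit`, `…RowStripDefs`, `…DeficitMinDefs`) quantifies every cell over charge tables
`BilayerChargeAdmissible A₁ A₂ c m`, i.e. DOMINATED BY LAW `(1, ½)`: `c i j ≤ 1` always, `≤ ½ sin` if co-axial distinct, `= 0` if
equal.  Law v5 charges non-co-axial pairs `13/25`; the texture build then only needs the cells for tables dominated by `13/25`.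
A table dominated by `c₀ ≤ 1` IS dominated by `1` (`bilayerChargeAdmissible_of_at`), so every LANDED cell theorem applies verbatim
to `c₀`-tables; only the statements whose proof is still OWED get the weaker `c₀`-form.  Everything here is PARAMETRIC in `c₀`
(the v5 names are the instances at `13 / 25`), so a later move of the law constant costs nothing.

* §1 `BilayerChargeAdmissibleAt c₀` (= `BilayerChargeAdmissible` with `c ≤ 1` replaced by `c ≤ c₀`), `bilayerChargeAdmissible_of_at`
  (`c₀ ≤ 1`), `bilayerChargeAdmissibleAt_mono`, `…At_one_iff` (`Iff.rfl`), `…At_flip₁/₂` (presentation flips, as the v4 ones);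
* §2 `BilayerWallCharged c₀` (= `BilayerWall` with `(∀ i j, c i j ≤ 1)` replaced by `(∀ i j, c i j ≤ c₀)`), `BilayerWallV5 :=
  BilayerWallCharged (13/25)`, `bilayerWall_iff_charged_one` (`Iff.rfl`), `bilayerWallCharged_anti`, `bilayerWallV5_of_bilayerWall`;
* §3 the G/T split at cap `c₀`: `BilayerWallGenericAt c₀ C R₀`, `BilayerWallResidualAt c₀ C R₀` (+ `…_of_generic/residual`);
* §4 the OWED cells at cap `c₀`, each = the landed v4 definition with `BilayerChargeAdmissible` ↦ `BilayerChargeAdmissibleAt c₀`: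
  `BilayerWallBetaIIIAt` ((β-iii), lane G at `c₀`), `BilayerWallFaultedOnReachCoaxialAt` / `BilayerWallFaultedZigCoaxialAt` (T-F2),
  `HStripPayerPoolAt` (Deficit-MIN payer pool) — with the free directions strong ⇒ weak (`betaIIIAt_of_betaIII`, …);
* §5 the WAY STATIONS of the `At R₀` glue at cap `c₀` (the classes the composition passes through between the owed cells and
  `BilayerWallCharged c₀`): `BilayerWallOnReachCoaxialAt`, `BilayerWallZigCoaxialAt`, `BilayerWallOnReachWeakZigAt`,
  `BilayerWallOnReachAllAt OffR`, `BilayerWallDeficitMinAt` (+ strong ⇒ weak).  The shared/twin coincidence classes need no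
  `c₀`-twin (they are fed from the co-axial class by `coaxialClass_of_sharedClass` / `…twinClass`), nor do the CLOSED strong
  parts (walker-covered, row-covered, zig-frames-apart, F-U `CoaxialUnifAt`), consumed through `bilayerChargeAdmissible_of_at`.
The glue `bilayerWallV5_of_stubsAt` is the next file (`…TexShadowAtGlueV5`, P4).
WHAT THIS IS NOT: no proof of any wall law; the v4 (`c₀ = 1`) statements are untouched and remain the strong forms; F-C1 not moved.
-/

noncomputable section

open scoped BigOperators InnerProductSpace ENNReal
open MeasureTheory Filter

namespace Summit.Ventures.Crystal3D.Cruxes.TextureLiminf.TexShadow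

open Summit.Ventures.Crystal3D Summit.Ventures.Crystal3D.Theorems
open Literature.MathematicalPhysics.StatisticalMechanics (IsHaggSeq fccStacking barlowStacking contactDeficiency basalMirror)

/-! ## §1 Charge tables dominated by the law `(c₀, ½)` -/

/-- The pair charges `c i j ≥ 0` (with shared axes `m i j`) are ADMISSIBLE AT CAP `c₀` for the bilayer frames `A₁ i`, `A₂ j`:
dominated by P's law `(c₀, ½)` for the normal `e₃` — `c ≤ c₀` always, `c ≤ ½ sin∠(e₃, m)` if co-axial with distinct lattices,
`c = 0` for equal lattices.  `BilayerChargeAdmissible` is the instance `c₀ = 1` (`bilayerChargeAdmissibleAt_one_iff`). -/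
def BilayerChargeAdmissibleAt (c₀ : ℝ) (A₁ A₂ : ℤ → (E3 ≃ₗᵢ[ℝ] E3)) (c : ℤ → ℤ → ℝ) (m : ℤ → ℤ → E3) : Prop :=
  (∀ i j, 0 ≤ c i j) ∧ (∀ i j, c i j ≤ c₀) ∧
    (∀ i j, CoAx (A₁ i) (A₂ j) → A₁ i '' fccRef ≠ A₂ j '' fccRef →
      SharedAxis (m i j) (A₁ i) (A₂ j) ∧ c i j ≤ 1 / 2 * Real.sqrt (1 - ⟪m i j, e₃⟫_ℝ ^ 2)) ∧
    (∀ i j, A₁ i '' fccRef = A₂ j '' fccRef → c i j = 0)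

/-- `BilayerChargeAdmissible` IS admissibility at cap `1`. -/
theorem bilayerChargeAdmissibleAt_one_iff {A₁ A₂ : ℤ → (E3 ≃ₗᵢ[ℝ] E3)} {c : ℤ → ℤ → ℝ} {m : ℤ → ℤ → E3} :
    BilayerChargeAdmissibleAt 1 A₁ A₂ c m ↔ BilayerChargeAdmissible A₁ A₂ c m :=
  Iff.rfl

/-- **The inclusion that makes the port cheap**: a table admissible at cap `c₀ ≤ 1` is admissible (at cap `1`). -/
theorem bilayerChargeAdmissible_of_at {c₀ : ℝ} (hc₀ : c₀ ≤ 1) {A₁ A₂ : ℤ → (E3 ≃ₗᵢ[ℝ] E3)} {c : ℤ → ℤ → ℝ}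
    {m : ℤ → ℤ → E3} (h : BilayerChargeAdmissibleAt c₀ A₁ A₂ c m) : BilayerChargeAdmissible A₁ A₂ c m :=
  ⟨h.1, fun i j => (h.2.1 i j).trans hc₀, h.2.2.1, h.2.2.2⟩

/-- Monotonicity in the cap. -/
theorem bilayerChargeAdmissibleAt_mono {c₀ c₀' : ℝ} (hc : c₀ ≤ c₀') {A₁ A₂ : ℤ → (E3 ≃ₗᵢ[ℝ] E3)} {c : ℤ → ℤ → ℝ}
    {m : ℤ → ℤ → E3} (h : BilayerChargeAdmissibleAt c₀ A₁ A₂ c m) : BilayerChargeAdmissibleAt c₀' A₁ A₂ c m :=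
  ⟨h.1, fun i j => (h.2.1 i j).trans hc, h.2.2.1, h.2.2.2⟩

/-- An admissible table bounded by `c₀` entrywise is admissible at cap `c₀`. -/
theorem bilayerChargeAdmissibleAt_of_le {c₀ : ℝ} {A₁ A₂ : ℤ → (E3 ≃ₗᵢ[ℝ] E3)} {c : ℤ → ℤ → ℝ} {m : ℤ → ℤ → E3}
    (h : BilayerChargeAdmissible A₁ A₂ c m) (hle : ∀ i j, c i j ≤ c₀) : BilayerChargeAdmissibleAt c₀ A₁ A₂ c m :=
  ⟨h.1, hle, h.2.2.1, h.2.2.2⟩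

/-- Admissibility at cap `c₀`, plate 1 re-indexed (presentation flip). -/
theorem bilayerChargeAdmissibleAt_flip₁ {c₀ : ℝ} {A₁ A₂ : ℤ → (E3 ≃ₗᵢ[ℝ] E3)} {c : ℤ → ℤ → ℝ} {m : ℤ → ℤ → E3}
    (h : BilayerChargeAdmissibleAt c₀ A₁ A₂ c m) :
    BilayerChargeAdmissibleAt c₀ (fun i => A₁ (-i - 1)) A₂ (fun i j => c (-i - 1) j) (fun i j => m (-i - 1) j) :=
  ⟨fun _ _ => h.1 _ _, fun _ _ => h.2.1 _ _, fun _ _ => h.2.2.1 _ _, fun _ _ => h.2.2.2 _ _⟩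

/-- Admissibility at cap `c₀`, plate 2 re-indexed (presentation flip). -/
theorem bilayerChargeAdmissibleAt_flip₂ {c₀ : ℝ} {A₁ A₂ : ℤ → (E3 ≃ₗᵢ[ℝ] E3)} {c : ℤ → ℤ → ℝ} {m : ℤ → ℤ → E3}
    (h : BilayerChargeAdmissibleAt c₀ A₁ A₂ c m) :
    BilayerChargeAdmissibleAt c₀ A₁ (fun j => A₂ (-j - 1)) (fun i j => c i (-j - 1)) (fun i j => m i (-j - 1)) :=
  ⟨fun _ _ => h.1 _ _, fun _ _ => h.2.1 _ _, fun _ _ => h.2.2.1 _ _, fun _ _ => h.2.2.2 _ _⟩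

/-! ## §2 The two-plate wall law at cap `c₀`, and `BilayerWallV5` -/

/-- **TWO-PLATE WALL LAW WITH BILAYER-PAIR CHARGES AT CAP `c₀`**: VERBATIM `BilayerWall` (…TexShadowSplitDefs §2) with the
hypothesis `(∀ i j, c i j ≤ 1)` replaced by `(∀ i j, c i j ≤ c₀)` — the cell inequality is claimed for the charge tables dominated by
the law `(c₀, ½)` only.  `BilayerWall` is the instance `c₀ = 1` (`bilayerWall_iff_charged_one`); smaller cap = weaker law
(`bilayerWallCharged_anti`). -/
def BilayerWallCharged (c₀ : ℝ) : Prop :=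
  ∃ C R₀ : ℝ, 1 ≤ R₀ ∧ ∀ (σ₁ σ₂ : ℤ → ℤ), IsHaggSeq σ₁ → IsHaggSeq σ₂ →
    ∀ (L₁ L₂ : E3 ≃ₗᵢ[ℝ] E3) (s₁ s₂ : E3) (A₁ A₂ : ℤ → (E3 ≃ₗᵢ[ℝ] E3)),
    (∀ i, ∃ u : E3, bilayer L₁ s₁ σ₁ i ⊆ (fun r => A₁ i r + u) '' fccRef) →
    (∀ j, ∃ u : E3, bilayer L₂ s₂ σ₂ j ⊆ (fun r => A₂ j r + u) '' fccRef) →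
    ∀ (c : ℤ → ℤ → ℝ) (m : ℤ → ℤ → E3), (∀ i j, 0 ≤ c i j) →
    (∀ i j, c i j ≤ c₀) →
    (∀ i j, CoAx (A₁ i) (A₂ j) → A₁ i '' fccRef ≠ A₂ j '' fccRef →
      SharedAxis (m i j) (A₁ i) (A₂ j) ∧ c i j ≤ 1 / 2 * Real.sqrt (1 - ⟪m i j, e₃⟫_ℝ ^ 2)) →
    (∀ i j, A₁ i '' fccRef = A₂ j '' fccRef → c i j = 0) →
    ∀ h : ℝ, 0 ≤ h → ∀ ρ : ℝ, R₀ ≤ ρ → ∀ X P₁ P₂ : Finset E3,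
      (∀ p ∈ X, ∀ q ∈ X, p ≠ q → 1 ≤ dist p q) → P₁ ⊆ X → P₂ ⊆ X \ P₁ → (∀ p ∈ X, p ∈ cyl R₀ h ρ) →
      (∀ p, p ∈ P₁ ↔ (p ∈ stacking L₁ s₁ σ₁ ∧ -(2 * R₀) ≤ p 2 ∧ p 2 ≤ -R₀ ∧
        p 0 ^ 2 + p 1 ^ 2 ≤ ρ ^ 2)) →
      (∀ p, p ∈ P₂ ↔ (p ∈ stacking L₂ s₂ σ₂ ∧ h + R₀ ≤ p 2 ∧ p 2 ≤ h + 2 * R₀ ∧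
        p 0 ^ 2 + p 1 ^ 2 ≤ ρ ^ 2)) →
      ((((P₁ ×ˢ (X \ P₁)).filter fun pq => dist pq.1 pq.2 = 1).card : ℕ) : ℝ) +
        ((((P₂ ×ˢ ((X \ P₁) \ P₂)).filter fun pq => dist pq.1 pq.2 = 1).card : ℕ) : ℝ) ≤
        contactDeficiency ((X \ P₁) \ P₂) +
          1 / 2 * innerBonds (stacking L₁ s₁ σ₁) P₁ (fun q => -R₀ < q 2) +
          1 / 2 * innerBonds (stacking L₂ s₂ σ₂) P₂ (fun q => q 2 < h + R₀) -
          (∑' ij : ℤ × ℤ, c ij.1 ij.2 *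
            (volume ({q : E3 | 0 ≤ q 2 ∧ q 2 ≤ 1 ∧ q 0 ^ 2 + q 1 ^ 2 ≤ ρ ^ 2} ∩
              laySlab L₁ s₁ ij.1 ∩ laySlab L₂ s₂ ij.2)).toReal) +
          C * (1 + h) * ρ

/-- **`BilayerWallV5`** — the two-plate wall law at the law-v5 cap `c₀ = 13/25` (the `BilayerWall` input of TexShadow v7's
`stub_textureBuild`). -/
def BilayerWallV5 : Prop := BilayerWallCharged (13 / 25)

/-- `BilayerWall` IS the wall law at cap `1`. -/
theorem bilayerWall_iff_charged_one : BilayerWall ↔ BilayerWallCharged 1 := Iff.rfl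

/-- Smaller cap, weaker law. -/
theorem bilayerWallCharged_anti {c₀ c₀' : ℝ} (hc : c₀ ≤ c₀') (h : BilayerWallCharged c₀') : BilayerWallCharged c₀ := by
  obtain ⟨C, R₀, hR₀, h⟩ := h
  exact ⟨C, R₀, hR₀, fun σ₁ σ₂ hσ₁ hσ₂ L₁ L₂ s₁ s₂ A₁ A₂ hA₁ hA₂ c m hc0 hc1 =>
    h σ₁ σ₂ hσ₁ hσ₂ L₁ L₂ s₁ s₂ A₁ A₂ hA₁ hA₂ c m hc0 fun i j => (hc1 i j).trans hc⟩

/-- The strong (v4) wall law gives the v5 one. -/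
theorem bilayerWallV5_of_bilayerWall (h : BilayerWall) : BilayerWallV5 :=
  bilayerWallCharged_anti (by norm_num) (bilayerWall_iff_charged_one.1 h)

/-! ## §3 The G/T split at cap `c₀` -/

/-- **GENERIC PART of the wall law at cap `c₀` and constants `(C, R₀)`** (`BilayerWallGeneric` with `c₀`-admissible tables). -/
def BilayerWallGenericAt (c₀ C R₀ : ℝ) : Prop :=
  ∀ (σ₁ σ₂ : ℤ → ℤ), IsHaggSeq σ₁ → IsHaggSeq σ₂ →
    ∀ (L₁ L₂ : E3 ≃ₗᵢ[ℝ] E3) (s₁ s₂ : E3) (A₁ A₂ : ℤ → (E3 ≃ₗᵢ[ℝ] E3)) (u₁ u₂ : ℤ → E3),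
    BilayerFramesAt L₁ s₁ σ₁ A₁ u₁ → BilayerFramesAt L₂ s₂ σ₂ A₂ u₂ →
    (∀ i j : ℤ, ¬ InResidualClass (A₁ i) (A₂ j) (u₁ i) (u₂ j)) →
    ∀ (c : ℤ → ℤ → ℝ) (m : ℤ → ℤ → E3), BilayerChargeAdmissibleAt c₀ A₁ A₂ c m →
      BilayerWallAt C R₀ σ₁ σ₂ L₁ L₂ s₁ s₂ c

/-- **RESIDUAL PART of the wall law at cap `c₀` and constants `(C, R₀)`** (`BilayerWallResidual` with `c₀`-admissible tables):
under law v5 the registered residual is priced at charge `c₀` by the same named fact `ResidualOneSidedCoverage c₀` as (β-iii). -/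
def BilayerWallResidualAt (c₀ C R₀ : ℝ) : Prop :=
  ∀ (σ₁ σ₂ : ℤ → ℤ), IsHaggSeq σ₁ → IsHaggSeq σ₂ →
    ∀ (L₁ L₂ : E3 ≃ₗᵢ[ℝ] E3) (s₁ s₂ : E3) (A₁ A₂ : ℤ → (E3 ≃ₗᵢ[ℝ] E3)) (u₁ u₂ : ℤ → E3),
    BilayerFramesAt L₁ s₁ σ₁ A₁ u₁ → BilayerFramesAt L₂ s₂ σ₂ A₂ u₂ →
    (∃ i j : ℤ, InResidualClass (A₁ i) (A₂ j) (u₁ i) (u₂ j)) →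
    ∀ (c : ℤ → ℤ → ℝ) (m : ℤ → ℤ → E3), BilayerChargeAdmissibleAt c₀ A₁ A₂ c m →
      BilayerWallAt C R₀ σ₁ σ₂ L₁ L₂ s₁ s₂ c

/-- Strong generic part ⇒ generic part at cap `c₀ ≤ 1`. -/
theorem bilayerWallGenericAt_of_generic {c₀ C R₀ : ℝ} (hc₀ : c₀ ≤ 1) (h : BilayerWallGeneric C R₀) :
    BilayerWallGenericAt c₀ C R₀ :=
  fun σ₁ σ₂ hσ₁ hσ₂ L₁ L₂ s₁ s₂ A₁ A₂ u₁ u₂ hA₁ hA₂ hgen c m hadm =>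
    h σ₁ σ₂ hσ₁ hσ₂ L₁ L₂ s₁ s₂ A₁ A₂ u₁ u₂ hA₁ hA₂ hgen c m (bilayerChargeAdmissible_of_at hc₀ hadm)

/-- Strong residual part ⇒ residual part at cap `c₀ ≤ 1`. -/
theorem bilayerWallResidualAt_of_residual {c₀ C R₀ : ℝ} (hc₀ : c₀ ≤ 1) (h : BilayerWallResidual C R₀) :
    BilayerWallResidualAt c₀ C R₀ :=
  fun σ₁ σ₂ hσ₁ hσ₂ L₁ L₂ s₁ s₂ A₁ A₂ u₁ u₂ hA₁ hA₂ hres c m hadm =>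
    h σ₁ σ₂ hσ₁ hσ₂ L₁ L₂ s₁ s₂ A₁ A₂ u₁ u₂ hA₁ hA₂ hres c m (bilayerChargeAdmissible_of_at hc₀ hadm)

/-! ## §4 The OWED cells at cap `c₀`: (β-iii), T-F2 (two keys), the Deficit-MIN payer pool -/

/-- **The (β-iii) carve-out at cap `c₀`** (`BilayerWallBetaIII` with `c₀`-admissible tables): lane G's seven priced cells (six `Σ9`
cells + separated-wide) for the NON-co-axial `(0,0)` bilayer frames of a `BothFcc` pair, at charge `c₀` — the T-side name of
`genericWallFloorAtCharge_all_of_coverage` at `c₀` (modulo the named fact `ResidualOneSidedCoverage c₀`). -/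
def BilayerWallBetaIIIAt (c₀ C R₀ : ℝ) : Prop :=
  ∀ (σ₁ σ₂ : ℤ → ℤ), IsHaggSeq σ₁ → IsHaggSeq σ₂ → BothFcc σ₁ σ₂ →
    ∀ (L₁ L₂ : E3 ≃ₗᵢ[ℝ] E3) (s₁ s₂ : E3) (A₁ A₂ : ℤ → (E3 ≃ₗᵢ[ℝ] E3)) (u₁ u₂ : ℤ → E3),
    BilayerFramesAt L₁ s₁ σ₁ A₁ u₁ → BilayerFramesAt L₂ s₂ σ₂ A₂ u₂ →
    (∀ i j : ℤ, ¬ InResidualClass (A₁ i) (A₂ j) (u₁ i) (u₂ j)) →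
    ∀ (c : ℤ → ℤ → ℝ) (m : ℤ → ℤ → E3), BilayerChargeAdmissibleAt c₀ A₁ A₂ c m →
      ¬ CoAx (A₁ 0) (A₂ 0) →
      (Sigma9OneSidedAt (A₁ 0) (A₂ 0) ∨ Sigma9OneSidedDownAt (A₁ 0) (A₂ 0) ∨ Sigma9TiltAt (A₁ 0) (A₂ 0) ∨
        Sigma9TiltDownAt (A₁ 0) (A₂ 0) ∨ Sigma9WideAt (A₁ 0) (A₂ 0) ∨ Sigma9WideDownAt (A₁ 0) (A₂ 0) ∨
        SeparatedWideAt (A₁ 0) (A₂ 0)) →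
      BilayerWallAt C R₀ σ₁ σ₂ L₁ L₂ s₁ s₂ c

/-- **T-F2, corner-keyed half, at cap `c₀`** (`BilayerWallFaultedOnReachCoaxial` with `c₀`-admissible tables). -/
def BilayerWallFaultedOnReachCoaxialAt (c₀ C R₀ : ℝ) : Prop :=
  ∀ (σ₁ σ₂ : ℤ → ℤ), IsHaggSeq σ₁ → IsHaggSeq σ₂ → ¬ BothFcc σ₁ σ₂ →
    ∀ (L₁ L₂ : E3 ≃ₗᵢ[ℝ] E3) (s₁ s₂ : E3) (A₁ A₂ : ℤ → (E3 ≃ₗᵢ[ℝ] E3)) (u₁ u₂ : ℤ → E3),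
    BilayerFramesAt L₁ s₁ σ₁ A₁ u₁ → BilayerFramesAt L₂ s₂ σ₂ A₂ u₂ →
    (∀ i j : ℤ, ¬ InResidualClass (A₁ i) (A₂ j) (u₁ i) (u₂ j)) →
    ∀ (c : ℤ → ℤ → ℝ) (m : ℤ → ℤ → E3), BilayerChargeAdmissibleAt c₀ A₁ A₂ c m → DomBy L₁ σ₁ L₂ σ₂ c →
      (∃ F₁ ∈ cornerFrames L₁ σ₁ e₃, ∃ F₂ ∈ cornerFrames L₂ σ₂ (-e₃), CoAxFrames F₁ F₂) →
      BilayerWallAt C R₀ σ₁ σ₂ L₁ L₂ s₁ s₂ c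

/-- **T-F2, zig-keyed half, at cap `c₀`** (`BilayerWallFaultedZigCoaxial` with `c₀`-admissible tables). -/
def BilayerWallFaultedZigCoaxialAt (c₀ C R₀ : ℝ) : Prop :=
  ∀ (σ₁ σ₂ : ℤ → ℤ), IsHaggSeq σ₁ → IsHaggSeq σ₂ → ¬ BothFcc σ₁ σ₂ →
    ∀ (L₁ L₂ : E3 ≃ₗᵢ[ℝ] E3) (s₁ s₂ : E3) (A₁ A₂ : ℤ → (E3 ≃ₗᵢ[ℝ] E3)) (u₁ u₂ : ℤ → E3),
    BilayerFramesAt L₁ s₁ σ₁ A₁ u₁ → BilayerFramesAt L₂ s₂ σ₂ A₂ u₂ →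
    (∀ i j : ℤ, ¬ InResidualClass (A₁ i) (A₂ j) (u₁ i) (u₂ j)) →
    ∀ (c : ℤ → ℤ → ℝ) (m : ℤ → ℤ → E3), BilayerChargeAdmissibleAt c₀ A₁ A₂ c m →
      DeltaSteep L₁ e₃ → DeltaSteep L₂ (-e₃) → FluxDominated (Real.sqrt 2 / 2) L₁ σ₁ L₂ σ₂ c →
      ¬ BarlowOffReach L₁ s₁ σ₁ L₂ s₂ σ₂ → ¬ RowMixDominated (Real.sqrt 2 / 2) L₁ σ₁ L₂ σ₂ c →
      ¬ (ZigGood L₁ σ₁ e₃ ∧ ZigGood L₂ σ₂ (-e₃)) →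
      (∃ F₁ ∈ zigFrames L₁ e₃, ∃ F₂ ∈ zigFrames L₂ (-e₃), CoAxFrames F₁ F₂) →
      BilayerWallAt C R₀ σ₁ σ₂ L₁ L₂ s₁ s₂ c

open scoped Classical in
/-- **Deficit-MIN as a PAYER POOL at cap `c₀`** (`HStripPayerPool` with `c₀`-admissible tables): on the Deficit-MIN class the whole
table charge of the cell is dominated by the payer sum, `2·Σ' c_ij·|slice ∩ slab₁ i ∩ slab₂ j| ≤ Σ_{PAY}(12 − deg) + C(1+h)ρ`
(literally the `hpay` of `bilayerWallAt_of_payerBound`); at cap `c₀` the certificate needs a pool of size `≥ c₀·area − C·ρ` only. -/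
def HStripPayerPoolAt (c₀ C R₀ : ℝ) : Prop :=
  ∀ (σ₁ σ₂ : ℤ → ℤ), IsHaggSeq σ₁ → IsHaggSeq σ₂ →
    ∀ (L₁ L₂ : E3 ≃ₗᵢ[ℝ] E3) (s₁ s₂ : E3) (A₁ A₂ : ℤ → (E3 ≃ₗᵢ[ℝ] E3)) (u₁ u₂ : ℤ → E3),
    BilayerFramesAt L₁ s₁ σ₁ A₁ u₁ → BilayerFramesAt L₂ s₂ σ₂ A₂ u₂ →
    (∀ i j : ℤ, ¬ InResidualClass (A₁ i) (A₂ j) (u₁ i) (u₂ j)) →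
    ∀ (c : ℤ → ℤ → ℝ) (m : ℤ → ℤ → E3), BilayerChargeAdmissibleAt c₀ A₁ A₂ c m →
      ¬ (DeltaSteep L₁ e₃ ∧ DeltaSteep L₂ (-e₃) ∧ FluxDominated (Real.sqrt 2 / 2) L₁ σ₁ L₂ σ₂ c) →
      ¬ RowMixDominated (Real.sqrt 2 / 2) L₁ σ₁ L₂ σ₂ c →
      ¬ RowMixDominated (Real.sqrt 2 / 2) (basalMirror.trans L₁) (fun n => -σ₁ (-n - 1)) L₂ σ₂ (fun i j => c (-i - 1) j) →
      ¬ RowMixDominated (Real.sqrt 2 / 2) L₁ σ₁ (basalMirror.trans L₂) (fun n => -σ₂ (-n - 1)) (fun i j => c i (-j - 1)) →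
      ¬ RowMixDominated (Real.sqrt 2 / 2) (basalMirror.trans L₁) (fun n => -σ₁ (-n - 1))
          (basalMirror.trans L₂) (fun n => -σ₂ (-n - 1)) (fun i j => c (-i - 1) (-j - 1)) →
      ∀ h : ℝ, 0 ≤ h → ∀ ρ : ℝ, R₀ ≤ ρ → ∀ X P₁ P₂ : Finset E3,
        (∀ p ∈ X, ∀ q ∈ X, p ≠ q → 1 ≤ dist p q) → P₁ ⊆ X → P₂ ⊆ X \ P₁ → (∀ p ∈ X, p ∈ cyl R₀ h ρ) →
        (∀ p, p ∈ P₁ ↔ (p ∈ stacking L₁ s₁ σ₁ ∧ -(2 * R₀) ≤ p 2 ∧ p 2 ≤ -R₀ ∧ p 0 ^ 2 + p 1 ^ 2 ≤ ρ ^ 2)) →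
        (∀ p, p ∈ P₂ ↔ (p ∈ stacking L₂ s₂ σ₂ ∧ h + R₀ ≤ p 2 ∧ p 2 ≤ h + 2 * R₀ ∧ p 0 ^ 2 + p 1 ^ 2 ≤ ρ ^ 2)) →
        2 * (∑' ij : ℤ × ℤ, c ij.1 ij.2 *
            (volume ({q : E3 | 0 ≤ q 2 ∧ q 2 ≤ 1 ∧ q 0 ^ 2 + q 1 ^ 2 ≤ ρ ^ 2} ∩ laySlab L₁ s₁ ij.1 ∩ laySlab L₂ s₂ ij.2)).toReal) ≤
          (∑ y ∈ X.filter (fun y => (X.filter fun q => dist y q = 1).card ≠ 12 ∧ -R₀ - 2 ≤ y 2 ∧ y 2 ≤ h + R₀ + 2),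
            ((12 : ℝ) - ((X.filter fun q => dist y q = 1).card : ℝ))) + C * (1 + h) * ρ

/-- Strong (β-iii) ⇒ (β-iii) at cap `c₀ ≤ 1` (the strong form is what v6.20 asked; v7 asks the cap-`13/25` form). -/
theorem betaIIIAt_of_betaIII {c₀ C R₀ : ℝ} (hc₀ : c₀ ≤ 1) (h : BilayerWallBetaIII C R₀) : BilayerWallBetaIIIAt c₀ C R₀ :=
  fun σ₁ σ₂ hσ₁ hσ₂ hfcc L₁ L₂ s₁ s₂ A₁ A₂ u₁ u₂ hA₁ hA₂ hgen c m hadm =>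
    h σ₁ σ₂ hσ₁ hσ₂ hfcc L₁ L₂ s₁ s₂ A₁ A₂ u₁ u₂ hA₁ hA₂ hgen c m (bilayerChargeAdmissible_of_at hc₀ hadm)

/-- Strong T-F2 (corner key) ⇒ cap `c₀ ≤ 1`. -/
theorem faultedOnReachCoaxialAt_of_faulted {c₀ C R₀ : ℝ} (hc₀ : c₀ ≤ 1) (h : BilayerWallFaultedOnReachCoaxial C R₀) :
    BilayerWallFaultedOnReachCoaxialAt c₀ C R₀ :=
  fun σ₁ σ₂ hσ₁ hσ₂ hf L₁ L₂ s₁ s₂ A₁ A₂ u₁ u₂ hA₁ hA₂ hgen c m hadm =>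
    h σ₁ σ₂ hσ₁ hσ₂ hf L₁ L₂ s₁ s₂ A₁ A₂ u₁ u₂ hA₁ hA₂ hgen c m (bilayerChargeAdmissible_of_at hc₀ hadm)

/-- Strong T-F2 (zig key) ⇒ cap `c₀ ≤ 1`. -/
theorem faultedZigCoaxialAt_of_faulted {c₀ C R₀ : ℝ} (hc₀ : c₀ ≤ 1) (h : BilayerWallFaultedZigCoaxial C R₀) :
    BilayerWallFaultedZigCoaxialAt c₀ C R₀ :=
  fun σ₁ σ₂ hσ₁ hσ₂ hf L₁ L₂ s₁ s₂ A₁ A₂ u₁ u₂ hA₁ hA₂ hgen c m hadm =>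
    h σ₁ σ₂ hσ₁ hσ₂ hf L₁ L₂ s₁ s₂ A₁ A₂ u₁ u₂ hA₁ hA₂ hgen c m (bilayerChargeAdmissible_of_at hc₀ hadm)

/-- Strong payer pool ⇒ payer pool at cap `c₀ ≤ 1`. -/
theorem hStripPayerPoolAt_of_pool {c₀ C R₀ : ℝ} (hc₀ : c₀ ≤ 1) (h : HStripPayerPool C R₀) : HStripPayerPoolAt c₀ C R₀ :=
  fun σ₁ σ₂ hσ₁ hσ₂ L₁ L₂ s₁ s₂ A₁ A₂ u₁ u₂ hA₁ hA₂ hgen c m hadm =>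
    h σ₁ σ₂ hσ₁ hσ₂ L₁ L₂ s₁ s₂ A₁ A₂ u₁ u₂ hA₁ hA₂ hgen c m (bilayerChargeAdmissible_of_at hc₀ hadm)

/-! ## §5 The way stations of the glue at cap `c₀` -/

/-- **ON-REACH, COAXIAL FRAMES (O3) at cap `c₀`** (`BilayerWallOnReachCoaxial` with `c₀`-admissible tables). -/
def BilayerWallOnReachCoaxialAt (c₀ C R₀ : ℝ) : Prop :=
  ∀ (σ₁ σ₂ : ℤ → ℤ), IsHaggSeq σ₁ → IsHaggSeq σ₂ →
    ∀ (L₁ L₂ : E3 ≃ₗᵢ[ℝ] E3) (s₁ s₂ : E3) (A₁ A₂ : ℤ → (E3 ≃ₗᵢ[ℝ] E3)) (u₁ u₂ : ℤ → E3),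
    BilayerFramesAt L₁ s₁ σ₁ A₁ u₁ → BilayerFramesAt L₂ s₂ σ₂ A₂ u₂ →
    (∀ i j : ℤ, ¬ InResidualClass (A₁ i) (A₂ j) (u₁ i) (u₂ j)) →
    ∀ (c : ℤ → ℤ → ℝ) (m : ℤ → ℤ → E3), BilayerChargeAdmissibleAt c₀ A₁ A₂ c m → DomBy L₁ σ₁ L₂ σ₂ c →
      (∃ F₁ ∈ cornerFrames L₁ σ₁ e₃, ∃ F₂ ∈ cornerFrames L₂ σ₂ (-e₃), CoAxFrames F₁ F₂) →
      BilayerWallAt C R₀ σ₁ σ₂ L₁ L₂ s₁ s₂ c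

/-- **WEAK ZIG, COAXIAL FRAMES (ZO3) at cap `c₀`** (`BilayerWallZigCoaxial` with `c₀`-admissible tables). -/
def BilayerWallZigCoaxialAt (c₀ C R₀ : ℝ) : Prop :=
  ∀ (σ₁ σ₂ : ℤ → ℤ), IsHaggSeq σ₁ → IsHaggSeq σ₂ →
    ∀ (L₁ L₂ : E3 ≃ₗᵢ[ℝ] E3) (s₁ s₂ : E3) (A₁ A₂ : ℤ → (E3 ≃ₗᵢ[ℝ] E3)) (u₁ u₂ : ℤ → E3),
    BilayerFramesAt L₁ s₁ σ₁ A₁ u₁ → BilayerFramesAt L₂ s₂ σ₂ A₂ u₂ →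
    (∀ i j : ℤ, ¬ InResidualClass (A₁ i) (A₂ j) (u₁ i) (u₂ j)) →
    ∀ (c : ℤ → ℤ → ℝ) (m : ℤ → ℤ → E3), BilayerChargeAdmissibleAt c₀ A₁ A₂ c m →
      DeltaSteep L₁ e₃ → DeltaSteep L₂ (-e₃) → FluxDominated (Real.sqrt 2 / 2) L₁ σ₁ L₂ σ₂ c →
      ¬ BarlowOffReach L₁ s₁ σ₁ L₂ s₂ σ₂ → ¬ RowMixDominated (Real.sqrt 2 / 2) L₁ σ₁ L₂ σ₂ c →
      ¬ (ZigGood L₁ σ₁ e₃ ∧ ZigGood L₂ σ₂ (-e₃)) →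
      (∃ F₁ ∈ zigFrames L₁ e₃, ∃ F₂ ∈ zigFrames L₂ (-e₃), CoAxFrames F₁ F₂) →
      BilayerWallAt C R₀ σ₁ σ₂ L₁ L₂ s₁ s₂ c

/-- **ON-REACH, WEAK ZIG (W) at cap `c₀`** (`BilayerWallOnReachWeakZig` with `c₀`-admissible tables). -/
def BilayerWallOnReachWeakZigAt (c₀ C R₀ : ℝ) : Prop :=
  ∀ (σ₁ σ₂ : ℤ → ℤ), IsHaggSeq σ₁ → IsHaggSeq σ₂ →
    ∀ (L₁ L₂ : E3 ≃ₗᵢ[ℝ] E3) (s₁ s₂ : E3) (A₁ A₂ : ℤ → (E3 ≃ₗᵢ[ℝ] E3)) (u₁ u₂ : ℤ → E3),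
    BilayerFramesAt L₁ s₁ σ₁ A₁ u₁ → BilayerFramesAt L₂ s₂ σ₂ A₂ u₂ →
    (∀ i j : ℤ, ¬ InResidualClass (A₁ i) (A₂ j) (u₁ i) (u₂ j)) →
    ∀ (c : ℤ → ℤ → ℝ) (m : ℤ → ℤ → E3), BilayerChargeAdmissibleAt c₀ A₁ A₂ c m →
      DeltaSteep L₁ e₃ → DeltaSteep L₂ (-e₃) → FluxDominated (Real.sqrt 2 / 2) L₁ σ₁ L₂ σ₂ c →
      ¬ BarlowOffReach L₁ s₁ σ₁ L₂ s₂ σ₂ → ¬ RowMixDominated (Real.sqrt 2 / 2) L₁ σ₁ L₂ σ₂ c →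
      ¬ (ZigGood L₁ σ₁ e₃ ∧ ZigGood L₂ σ₂ (-e₃)) →
      BilayerWallAt C R₀ σ₁ σ₂ L₁ L₂ s₁ s₂ c

/-- **ON-REACH PART at cap `c₀`** for the pair off-reach predicate `OffR` (`BilayerWallOnReachAll OffR` with `c₀`-admissible tables). -/
def BilayerWallOnReachAllAt (OffR : (E3 ≃ₗᵢ[ℝ] E3) → E3 → (ℤ → ℤ) → (E3 ≃ₗᵢ[ℝ] E3) → E3 → (ℤ → ℤ) → Prop)
    (c₀ C R₀ : ℝ) : Prop :=
  ∀ (σ₁ σ₂ : ℤ → ℤ), IsHaggSeq σ₁ → IsHaggSeq σ₂ →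
    ∀ (L₁ L₂ : E3 ≃ₗᵢ[ℝ] E3) (s₁ s₂ : E3) (A₁ A₂ : ℤ → (E3 ≃ₗᵢ[ℝ] E3)) (u₁ u₂ : ℤ → E3),
    BilayerFramesAt L₁ s₁ σ₁ A₁ u₁ → BilayerFramesAt L₂ s₂ σ₂ A₂ u₂ →
    (∀ i j : ℤ, ¬ InResidualClass (A₁ i) (A₂ j) (u₁ i) (u₂ j)) →
    ∀ (c : ℤ → ℤ → ℝ) (m : ℤ → ℤ → E3), BilayerChargeAdmissibleAt c₀ A₁ A₂ c m →
      ((DeltaSteep L₁ e₃ ∧ DeltaSteep L₂ (-e₃) ∧ FluxDominated (Real.sqrt 2 / 2) L₁ σ₁ L₂ σ₂ c ∧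
          ¬ BarlowOffReach L₁ s₁ σ₁ L₂ s₂ σ₂) ∨
        (RowMixDominated (Real.sqrt 2 / 2) L₁ σ₁ L₂ σ₂ c ∧ ¬ OffR L₁ s₁ σ₁ L₂ s₂ σ₂)) →
      BilayerWallAt C R₀ σ₁ σ₂ L₁ L₂ s₁ s₂ c

/-- **DEFICIENT PART MINUS ALL PRESENTATION FLIPS at cap `c₀`** (`BilayerWallDeficitMin` with `c₀`-admissible tables). -/
def BilayerWallDeficitMinAt (c₀ C R₀ : ℝ) : Prop :=
  ∀ (σ₁ σ₂ : ℤ → ℤ), IsHaggSeq σ₁ → IsHaggSeq σ₂ →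
    ∀ (L₁ L₂ : E3 ≃ₗᵢ[ℝ] E3) (s₁ s₂ : E3) (A₁ A₂ : ℤ → (E3 ≃ₗᵢ[ℝ] E3)) (u₁ u₂ : ℤ → E3),
    BilayerFramesAt L₁ s₁ σ₁ A₁ u₁ → BilayerFramesAt L₂ s₂ σ₂ A₂ u₂ →
    (∀ i j : ℤ, ¬ InResidualClass (A₁ i) (A₂ j) (u₁ i) (u₂ j)) →
    ∀ (c : ℤ → ℤ → ℝ) (m : ℤ → ℤ → E3), BilayerChargeAdmissibleAt c₀ A₁ A₂ c m →
      ¬ (DeltaSteep L₁ e₃ ∧ DeltaSteep L₂ (-e₃) ∧ FluxDominated (Real.sqrt 2 / 2) L₁ σ₁ L₂ σ₂ c) →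
      ¬ RowMixDominated (Real.sqrt 2 / 2) L₁ σ₁ L₂ σ₂ c →
      ¬ RowMixDominated (Real.sqrt 2 / 2) (basalMirror.trans L₁) (fun n => -σ₁ (-n - 1)) L₂ σ₂ (fun i j => c (-i - 1) j) →
      ¬ RowMixDominated (Real.sqrt 2 / 2) L₁ σ₁ (basalMirror.trans L₂) (fun n => -σ₂ (-n - 1)) (fun i j => c i (-j - 1)) →
      ¬ RowMixDominated (Real.sqrt 2 / 2) (basalMirror.trans L₁) (fun n => -σ₁ (-n - 1))
          (basalMirror.trans L₂) (fun n => -σ₂ (-n - 1)) (fun i j => c (-i - 1) (-j - 1)) →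
      BilayerWallAt C R₀ σ₁ σ₂ L₁ L₂ s₁ s₂ c

/-- Strong O3 ⇒ O3 at cap `c₀ ≤ 1`. -/
theorem onReachCoaxialAt_of_onReachCoaxial {c₀ C R₀ : ℝ} (hc₀ : c₀ ≤ 1) (h : BilayerWallOnReachCoaxial C R₀) :
    BilayerWallOnReachCoaxialAt c₀ C R₀ :=
  fun σ₁ σ₂ hσ₁ hσ₂ L₁ L₂ s₁ s₂ A₁ A₂ u₁ u₂ hA₁ hA₂ hgen c m hadm =>
    h σ₁ σ₂ hσ₁ hσ₂ L₁ L₂ s₁ s₂ A₁ A₂ u₁ u₂ hA₁ hA₂ hgen c m (bilayerChargeAdmissible_of_at hc₀ hadm)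

/-- Strong ZO3 ⇒ ZO3 at cap `c₀ ≤ 1`. -/
theorem zigCoaxialAt_of_zigCoaxial {c₀ C R₀ : ℝ} (hc₀ : c₀ ≤ 1) (h : BilayerWallZigCoaxial C R₀) :
    BilayerWallZigCoaxialAt c₀ C R₀ :=
  fun σ₁ σ₂ hσ₁ hσ₂ L₁ L₂ s₁ s₂ A₁ A₂ u₁ u₂ hA₁ hA₂ hgen c m hadm =>
    h σ₁ σ₂ hσ₁ hσ₂ L₁ L₂ s₁ s₂ A₁ A₂ u₁ u₂ hA₁ hA₂ hgen c m (bilayerChargeAdmissible_of_at hc₀ hadm)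

/-- Strong W ⇒ W at cap `c₀ ≤ 1`. -/
theorem onReachWeakZigAt_of_onReachWeakZig {c₀ C R₀ : ℝ} (hc₀ : c₀ ≤ 1) (h : BilayerWallOnReachWeakZig C R₀) :
    BilayerWallOnReachWeakZigAt c₀ C R₀ :=
  fun σ₁ σ₂ hσ₁ hσ₂ L₁ L₂ s₁ s₂ A₁ A₂ u₁ u₂ hA₁ hA₂ hgen c m hadm =>
    h σ₁ σ₂ hσ₁ hσ₂ L₁ L₂ s₁ s₂ A₁ A₂ u₁ u₂ hA₁ hA₂ hgen c m (bilayerChargeAdmissible_of_at hc₀ hadm)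

/-- Strong on-reach part ⇒ on-reach part at cap `c₀ ≤ 1`. -/
theorem onReachAllAt_of_onReachAll {OffR : (E3 ≃ₗᵢ[ℝ] E3) → E3 → (ℤ → ℤ) → (E3 ≃ₗᵢ[ℝ] E3) → E3 → (ℤ → ℤ) → Prop}
    {c₀ C R₀ : ℝ} (hc₀ : c₀ ≤ 1) (h : BilayerWallOnReachAll OffR C R₀) : BilayerWallOnReachAllAt OffR c₀ C R₀ :=
  fun σ₁ σ₂ hσ₁ hσ₂ L₁ L₂ s₁ s₂ A₁ A₂ u₁ u₂ hA₁ hA₂ hgen c m hadm =>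
    h σ₁ σ₂ hσ₁ hσ₂ L₁ L₂ s₁ s₂ A₁ A₂ u₁ u₂ hA₁ hA₂ hgen c m (bilayerChargeAdmissible_of_at hc₀ hadm)

/-- Strong deficit-min part ⇒ deficit-min part at cap `c₀ ≤ 1`. -/
theorem deficitMinAt_of_deficitMin {c₀ C R₀ : ℝ} (hc₀ : c₀ ≤ 1) (h : BilayerWallDeficitMin C R₀) :
    BilayerWallDeficitMinAt c₀ C R₀ :=
  fun σ₁ σ₂ hσ₁ hσ₂ L₁ L₂ s₁ s₂ A₁ A₂ u₁ u₂ hA₁ hA₂ hgen c m hadm =>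
    h σ₁ σ₂ hσ₁ hσ₂ L₁ L₂ s₁ s₂ A₁ A₂ u₁ u₂ hA₁ hA₂ hgen c m (bilayerChargeAdmissible_of_at hc₀ hadm)

end Summit.Ventures.Crystal3D.Cruxes.TextureLiminf.TexShadow

end
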